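import Literature.Computability.AlgebraicComplexity.BI17InvariantsRectangularHighestWeight
import Literature.Computability.AlgebraicComplexity.BLMW11SylvesterPlethysmProofs
import HarnessLib

/-!
# BI 2017, Example 3.7: `E(2,2) = 2ℕ` (binary quadrics, via Hermite reciprocity and Howe), and the
# named fact reduced to the odd-degree vanishing for ternary cubics

Topic `Literature/Computability/AlgebraicComplexity`; theorems only (no definitions, no named
facts). Third file of this seat towards `BI2017_ex_3_7` (`BI17FundamentalInvariantForms.lean`,
val-lit-t04): P. Bürgisser, C. Ikenmeyer, *Fundamental invariants of orbit closures*, J. Algebra 477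
(2017), Example 3.7 (main.tex L823): "`E(2,2) = 2ℕ`, … computed with … [FH91, p. 153]".

* §1 **Hermite reciprocity for the two-row rectangle**: `a_{(d,d)}(d[2]) = a_{(d,d)}(2[d])`
  (`plethysmCoeff_rowDual_two_two_swap`), from Cayley–Sylvester in the tree's form
  (`plethysmCoeff_rowDual_three_add`, val-lit-p6: `a_{(L,b,0)}(d[n]) + p_{b-1}(d,n) = p_b(d,n)`) and
  the transpose symmetry of box partition counts (`boxPartitionCount_symm`, val-lit-t07).
* §2 **no odd-degree invariants of binary quadrics**: `a_{(d,d)}(d[2]) = 0` for odd `d`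
  (`plethysmCoeff_two_two_const_eq_zero_of_odd`): by §1 this is `a_{(d,d)}(2[d])`
  `= dim O(Sym^d ℂ²)^{SL_2}_2` (`finrank_slInvariantsOfDegree_eq_plethysmCoeff`, this seat), which is
  `0` for odd `d` by Howe's theorem (BI 2017 Thm. 3.14, `slInvariantsOfDegree_self_eq_bot_of_odd`,
  val-lit-t09/t01). Hence **`E(2,2) = 2ℕ`** (`genericDegreeMonoid_two_two`) — the first display of
  Ex. 3.7, PROVED.
* §3 `BI2017_ex_3_7_of_ternaryCubic_odd_vanishing`: the named fact now hinges on ONE statement,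
  `a_{(d,d,d)}(d[3]) = 0` for all odd `d` (ternary cubics have no invariants of odd degree; Aronhold,
  `ℂ[Sym³ℂ³]^{SL_3} = ℂ[S,T]`), which is not a finite computation.

Status of BI 2017 Ex. 3.7 in the tree after this file: `E(2,2) = 2ℕ` ✓, `e(3,3) = 4` ✓,
`E(4,4) = ℕ ∖ {1,2,3,5,9}` ✓, `e(4,4) = 4` ✓, `E(3,3) ⊇ 2(ℕ ∖ {1})` ✓ and `E(3,3) ∌ 1,2,3` ✓;
open: `E(3,3)` contains no odd `d ≥ 5`.

HONEST FRAMING (cell `val-lit`, rung V3, row BI17): classical invariant theory as typed-fact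
bookkeeping; nothing here bears on permanent versus determinant; VP ≠ VNP is NOT proved and nothing
in this file is progress on it.

## References
* [BurgisserIkenmeyer2017] P. Bürgisser, C. Ikenmeyer, J. Algebra 477 (2017), Ex. 3.7, Thm. 3.14.
* [FultonHarrisGTM129] W. Fulton, J. Harris, GTM 129, p. 153 / Ex. 11.34 (Hermite reciprocity), §15.5.
* [BurgisserEtAl2011] BLMW, SIAM J. Comput. 40 (2011), §8.3 (8.3.1) (Sylvester's formula).

## Tree
`plethysmCoeff_rowDual_two_eq_three`, `plethysmCoeff_rowDual_three_add` (`BLMW11SylvesterPlethysmProofs`);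
`boxPartitionCount_symm` (`DIP20MonomialCounts`); `finrank_slInvariantsOfDegree_eq_plethysmCoeff`,
`genericDegreeMonoid_two_two_of_odd_vanishing`, `BI2017_ex_3_7_of_odd_vanishing`
(`BI17InvariantsRectangularHighestWeight`); `slInvariantsOfDegree_self_eq_bot_of_odd`
(`BI17HoweInvariantsProofs`).

Provenance: val-lit cell, prover val-lit-p4 g4 (registry claim #1 on `BI2017_ex_3_7`).
-/

namespace Literature.Computability.AlgebraicComplexity

open MvPolynomial
open _root_.Literature.NumberTheory.DiophantineGeometry

/-! ### §1 Hermite reciprocity for the two-row rectangle `(d,d)` -/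

/-- **Hermite reciprocity for the rectangle `(d,d)`**: `a_{(d,d)}(d[2]) = a_{(d,d)}(2[d])` (`d ≥ 1`),
i.e. `mult((d,d), Sym^d Sym² ℂ²) = mult((d,d), Sym² Sym^d ℂ²)`: both equal `p_d − p_{d−1}` of box
partition counts (Cayley–Sylvester), and `p_r(d,2) = p_r(2,d)` (transpose).
[cite: FultonHarrisGTM129, Ex. 11.34 (Hermite reciprocity)] -/
theorem plethysmCoeff_rowDual_two_two_swap {d : ℕ} (hd : 0 < d) :
    plethysmCoeff ℂ (Fin 2) 2 (rowDual ![d, d]) = plethysmCoeff ℂ (Fin 2) d (rowDual ![d, d]) := by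
  have h1 := plethysmCoeff_rowDual_three_add 2 d d d (by norm_num) le_rfl (by ring)
  have h2 := plethysmCoeff_rowDual_three_add d 2 d d hd le_rfl (by ring)
  rw [plethysmCoeff_rowDual_two_eq_three 2 d d le_rfl, plethysmCoeff_rowDual_two_eq_three d d d le_rfl]
  rw [boxPartitionCount_symm d d 2, boxPartitionCount_symm (d - 1) d 2] at h1
  omega

/-! ### §2 Binary quadrics have no invariants of odd degree: `E(2,2) = 2ℕ` -/

/-- **`a_{(d,d)}(d[2]) = 0` for odd `d`**: by Hermite reciprocity this is
`a_{(d,d)}(2[d]) = dim O(Sym^d ℂ²)^{SL_2}_2`, and a binary form of ODD degree `d` has no quadratic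
invariant (Howe, BI 2017 Thm. 3.14: `O(Sym^D ℂ^m)^{SL_m}_m = 0` for odd `D`).
[cite: BurgisserIkenmeyer2017, Ex. 3.7] -/
theorem plethysmCoeff_two_two_const_eq_zero_of_odd {d : ℕ} (hd : Odd d) :
    plethysmCoeff ℂ (Fin 2) 2 (fun _ : Fin 2 => -(d : ℤ)) = 0 := by
  have hd0 : 0 < d := hd.pos
  have hrow : (fun _ : Fin 2 => -(d : ℤ)) = rowDual ![d, d] := by
    funext i
    fin_cases i <;> simp [rowDual, Weight.dual]
  rw [hrow, plethysmCoeff_rowDual_two_two_swap hd0]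
  -- `a_{(d,d)}(2[d]) = dim O(Sym^d ℂ²)^{SL_2}_2 = 0`
  have hfin := finrank_slInvariantsOfDegree_eq_plethysmCoeff (m := 2) (D := d) (d := 2) (by norm_num)
    hd0 ⟨d, by ring⟩
  have hrow' : (fun _ : Fin 2 => -((d * 2 / 2 : ℕ) : ℤ)) = rowDual ![d, d] := by
    rw [Nat.mul_div_cancel d (by norm_num : 0 < 2)]
    exact hrow
  rw [hrow'] at hfin
  rw [← hfin, slInvariantsOfDegree_self_eq_bot_of_odd (k := ℂ) hd le_rfl, finrank_bot]

/-- **BI 2017, Example 3.7, `E(2,2) = 2ℕ` — PROVED** (the invariants of binary quadrics live in even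
degrees: `ℂ[disc]`). [cite: BurgisserIkenmeyer2017, Ex. 3.7] -/
theorem genericDegreeMonoid_two_two : genericDegreeMonoid (Fin 2) ℂ 2 = {d | Even d} :=
  genericDegreeMonoid_two_two_of_odd_vanishing fun _ hd => plethysmCoeff_two_two_const_eq_zero_of_odd hd

/-! ### §3 The named fact, modulo the odd-degree vanishing for ternary cubics -/

/-- **BI 2017 Example 3.7 REDUCED to one statement**: if ternary cubics have no invariants of odd
degree (`a_{(d,d,d)}(d[3]) = 0` for odd `d`; Aronhold: the invariant ring is `ℂ[S,T]` with
`deg S = 4`, `deg T = 6`), then `BI2017_ex_3_7` holds. Everything else — `E(2,2) = 2ℕ`,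
`e(3,3) = 4`, `E(4,4) = ℕ ∖ {1,2,3,5,9}`, `e(4,4) = 4`, `E(3,3) ⊇ 2(ℕ ∖ {1})`, `1,2,3 ∉ E(3,3)` — is
proved unconditionally in this seat's three files. [cite: BurgisserIkenmeyer2017, Ex. 3.7] -/
theorem BI2017_ex_3_7_of_ternaryCubic_odd_vanishing
    (h33 : ∀ d : ℕ, Odd d → plethysmCoeff ℂ (Fin 3) 3 (fun _ : Fin 3 => -(d : ℤ)) = 0) :
    BI2017_ex_3_7 :=
  BI2017_ex_3_7_of_odd_vanishing (fun _ hd => plethysmCoeff_two_two_const_eq_zero_of_odd hd) h33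

end Literature.Computability.AlgebraicComplexity
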